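import Mathlib.Analysis.Calculus.MeanValue
import Mathlib.Analysis.Calculus.FDeriv.Symmetric
import Mathlib.Analysis.Calculus.FDeriv.CompCLM
import Mathlib.Topology.MetricSpace.Thickening
import Mathlib.Topology.MetricSpace.ProperSpace.Real
import Literature.Analysis.FluidPDE.BallisticFreeEnergy
import HarnessLib

/-!
# Second-order thermodynamics: Maxwell's relation and uniform linearisation bounds

Two `C²` ingredients of the weak–strong uniqueness argument of Březina–Feireisl 2018 (§3.2.2,
Steps 2–3, where the constitutive functions are tacitly `C²`):

* `EulerEOS.IsGibbs.maxwell` — the Maxwell relation `∂_ρ s(ρ,ϑ) = -∂_ϑ p(ρ,ϑ)/ρ²`, i.e. the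
  symmetry of the second derivative of the Helmholtz free energy `f = e - ϑ s`, whose first
  derivatives are `∂_ϑ f = -s` and `∂_ρ f = p/ρ²` by Gibbs' relation (1.5);
* `taylor_bounds_near_compact` — for `g ∈ C²` on an open `U ⊇ cthickening δ K`, `K` compact:
  uniform Lipschitz and second-order Taylor remainder bounds on the `δ`-boxes around the points of
  `K` (mean value inequality on convex boxes); this is the "≈" of BF Step 2 and the linearisation of
  `p` in Step 3.

## References

* J. Březina, E. Feireisl, J. Math. Soc. Japan 70 (2018), §3.2.2 Steps 2–3.
* E. Feireisl, A. Novotný, *Singular limits in thermodynamics of viscous fluids* (2009), §1.4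
  (Gibbs' and Maxwell's relations).
-/

noncomputable section

open Set Filter Function Metric
open scoped Topology

namespace Literature.Analysis.FluidPDE

namespace CompressibleEuler

/-! ## `C²` functions of two variables -/

section TwoVarC2

variable {g : ℝ → ℝ → ℝ} {U : Set (ℝ × ℝ)}

/-- For `g ∈ C²(U)`, `U` open: `D(uncurry g)` is differentiable on `U` and `D²(uncurry g)` is
continuous on `U`. [folklore] -/
theorem differentiableOn_fderiv_uncurry (hg : ContDiffOn ℝ 2 (uncurry g) U) (hU : IsOpen U) :
    DifferentiableOn ℝ (fderiv ℝ (uncurry g)) U ∧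
      ContinuousOn (fderiv ℝ (fderiv ℝ (uncurry g))) U := by
  rw [show (2 : WithTop ℕ∞) = 1 + 1 from by norm_num,
    contDiffOn_succ_iff_fderiv_of_isOpen hU] at hg
  exact ⟨hg.2.2.differentiableOn one_ne_zero, hg.2.2.continuousOn_fderiv_of_isOpen hU le_rfl⟩

/-- **Uniform linearisation near a compact set.** Let `g ∈ C²(U)`, `U` open, `K` compact with
`cthickening δ K ⊆ U`. There is `L ≥ 0` such that for every `(r,Θ) ∈ K` and every
`(ρ,ϑ)` with `|ρ - r|, |ϑ - Θ| ≤ δ`: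
`|g(ρ,ϑ) - g(r,Θ)| ≤ L (|ρ-r| + |ϑ-Θ|)` and
`|g(ρ,ϑ) - g(r,Θ) - ∂₁g(r,Θ)(ρ-r) - ∂₂g(r,Θ)(ϑ-Θ)| ≤ L ((ρ-r)² + (ϑ-Θ)²)`.
[folklore] -/
theorem taylor_bounds_near_compact (hg : ContDiffOn ℝ 2 (uncurry g) U) (hU : IsOpen U)
    {K : Set (ℝ × ℝ)} (hK : IsCompact K) {δ : ℝ} (hKδ : cthickening δ K ⊆ U) :
    ∃ L : ℝ, 0 ≤ L ∧ ∀ r Θ ρ ϑ : ℝ, (r, Θ) ∈ K → |ρ - r| ≤ δ → |ϑ - Θ| ≤ δ →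
      |g ρ ϑ - g r Θ| ≤ L * (|ρ - r| + |ϑ - Θ|) ∧
      |g ρ ϑ - g r Θ - deriv (fun x => g x Θ) r * (ρ - r) - deriv (fun θ => g r θ) Θ * (ϑ - Θ)|
        ≤ L * ((ρ - r) ^ 2 + (ϑ - Θ) ^ 2) := by
  set G := uncurry g with hGdef
  have hg1 : ContDiffOn ℝ 1 G U := hg.of_le (by norm_num)
  obtain ⟨hDdiff, hD2cont⟩ := differentiableOn_fderiv_uncurry hg hU
  have hK'c : IsCompact (cthickening δ K) := hK.cthickening
  -- bounds on `‖DG‖` and `‖D²G‖` over the thickening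
  obtain ⟨L₁, hL₁⟩ := hK'c.exists_bound_of_continuousOn
    ((hg1.continuousOn_fderiv_of_isOpen hU le_rfl).mono hKδ)
  obtain ⟨L₂, hL₂⟩ := hK'c.exists_bound_of_continuousOn (f := fderiv ℝ (fderiv ℝ G))
    (hD2cont.mono hKδ)
  have hL₁' : ∀ z ∈ cthickening δ K, ‖fderiv ℝ G z‖ ≤ max L₁ 0 := fun z hz =>
    (hL₁ z hz).trans (le_max_left _ _)
  have hL₂' : ∀ z ∈ cthickening δ K, ‖fderiv ℝ (fderiv ℝ G) z‖ ≤ max L₂ 0 := fun z hz =>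
    (hL₂ z hz).trans (le_max_left _ _)
  refine ⟨max (max L₁ 0) (max L₂ 0), le_max_of_le_left (le_max_right _ _),
    fun r Θ ρ ϑ hrΘ hρ hϑ => ?_⟩
  have hz₀U : (r, Θ) ∈ U := hKδ (self_subset_cthickening K hrΘ)
  set z₀ : ℝ × ℝ := (r, Θ) with hz₀
  set y : ℝ × ℝ := (ρ, ϑ) with hy
  have hdist : dist y z₀ = max |ρ - r| |ϑ - Θ| := by
    rw [Prod.dist_eq, Real.dist_eq, Real.dist_eq]
  have hnorm : ‖y - z₀‖ = max |ρ - r| |ϑ - Θ| := by rw [← dist_eq_norm, hdist]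
  set η : ℝ := max |ρ - r| |ϑ - Θ| with hη
  have hη_nonneg : 0 ≤ η := le_max_of_le_left (abs_nonneg _)
  have hηδ : η ≤ δ := max_le hρ hϑ
  -- the box of radius `η` around `z₀` is convex and inside the thickening
  have hball_sub : closedBall z₀ η ⊆ cthickening δ K := fun z hz =>
    mem_cthickening_of_dist_le z z₀ δ K hrΘ ((mem_closedBall.1 hz).trans hηδ)
  have hy_mem : y ∈ closedBall z₀ η := mem_closedBall.2 (le_of_eq hdist)
  have hz₀_mem : z₀ ∈ closedBall z₀ η := mem_closedBall_self hη_nonneg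
  have hdiffG : ∀ z ∈ closedBall z₀ η, DifferentiableAt ℝ G z := fun z hz =>
    (hg1.differentiableOn one_ne_zero z (hKδ (hball_sub hz))).differentiableAt
      (hU.mem_nhds (hKδ (hball_sub hz)))
  have hdiffDG : ∀ z ∈ closedBall z₀ η, DifferentiableAt ℝ (fderiv ℝ G) z := fun z hz =>
    (hDdiff z (hKδ (hball_sub hz))).differentiableAt (hU.mem_nhds (hKδ (hball_sub hz)))
  -- first order
  have h1 : ‖G y - G z₀‖ ≤ max L₁ 0 * ‖y - z₀‖ :=
    (convex_closedBall z₀ η).norm_image_sub_le_of_norm_fderiv_le hdiffG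
      (fun z hz => hL₁' z (hball_sub hz)) hz₀_mem hy_mem
  -- the derivative is `L₂`-Lipschitz on the box, hence within `L₂ η` of `DG z₀`
  have hD_close : ∀ z ∈ closedBall z₀ η, ‖fderiv ℝ G z - fderiv ℝ G z₀‖ ≤ max L₂ 0 * η := by
    intro z hz
    have := (convex_closedBall z₀ η).norm_image_sub_le_of_norm_fderiv_le hdiffDG
      (fun z hz => hL₂' z (hball_sub hz)) hz₀_mem hz
    refine this.trans (mul_le_mul_of_nonneg_left ?_ (le_max_right _ _))
    rw [← dist_eq_norm]; exact mem_closedBall.1 hz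
  -- second order
  have h2 : ‖G y - G z₀ - fderiv ℝ G z₀ (y - z₀)‖ ≤ max L₂ 0 * η * ‖y - z₀‖ :=
    (convex_closedBall z₀ η).norm_image_sub_le_of_norm_fderiv_le' hdiffG hD_close hz₀_mem hy_mem
  -- translate to coordinates
  have hGy : G y = g ρ ϑ := rfl
  have hGz : G z₀ = g r Θ := rfl
  have hlin : fderiv ℝ G z₀ (y - z₀) =
      deriv (fun x => g x Θ) r * (ρ - r) + deriv (fun θ => g r θ) Θ * (ϑ - Θ) := by
    have : y - z₀ = (ρ - r, ϑ - Θ) := rfl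
    rw [this, hGdef, fderiv_uncurry_apply hg1 hU le_rfl hz₀U]
    ring
  have hη_le_sum : η ≤ |ρ - r| + |ϑ - Θ| := max_le (le_add_of_nonneg_right (abs_nonneg _))
    (le_add_of_nonneg_left (abs_nonneg _))
  have hη_sq : η * η ≤ (ρ - r) ^ 2 + (ϑ - Θ) ^ 2 := by
    rcases le_total |ρ - r| |ϑ - Θ| with h | h
    · rw [hη, max_eq_right h, ← sq, sq_abs]; nlinarith [sq_nonneg (ρ - r)]
    · rw [hη, max_eq_left h, ← sq, sq_abs]; nlinarith [sq_nonneg (ϑ - Θ)]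
  constructor
  · rw [hGy, hGz, Real.norm_eq_abs, hnorm] at h1
    calc |g ρ ϑ - g r Θ| ≤ max L₁ 0 * η := h1
      _ ≤ max L₁ 0 * (|ρ - r| + |ϑ - Θ|) := mul_le_mul_of_nonneg_left hη_le_sum (le_max_right _ _)
      _ ≤ max (max L₁ 0) (max L₂ 0) * (|ρ - r| + |ϑ - Θ|) :=
          mul_le_mul_of_nonneg_right (le_max_left _ _) (by positivity)
  · rw [hGy, hGz, hlin, Real.norm_eq_abs, hnorm] at h2
    have : g ρ ϑ - g r Θ - deriv (fun x => g x Θ) r * (ρ - r) - deriv (fun θ => g r θ) Θ * (ϑ - Θ)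
        = g ρ ϑ - g r Θ - (deriv (fun x => g x Θ) r * (ρ - r) +
            deriv (fun θ => g r θ) Θ * (ϑ - Θ)) := by ring
    rw [this]
    calc |g ρ ϑ - g r Θ - (deriv (fun x => g x Θ) r * (ρ - r) + deriv (fun θ => g r θ) Θ * (ϑ - Θ))|
        ≤ max L₂ 0 * η * η := h2
      _ = max L₂ 0 * (η * η) := by ring
      _ ≤ max L₂ 0 * ((ρ - r) ^ 2 + (ϑ - Θ) ^ 2) :=
          mul_le_mul_of_nonneg_left hη_sq (le_max_right _ _)
      _ ≤ max (max L₁ 0) (max L₂ 0) * ((ρ - r) ^ 2 + (ϑ - Θ) ^ 2) :=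
          mul_le_mul_of_nonneg_right (le_max_right _ _) (by positivity)

/-- Mixed second derivatives commute, in slice form: if `g ∈ C²(U)`, `U` open, and on `U` the
partial derivatives are given by functions `g₁ = ∂₁g`, `g₂ = ∂₂g` which are themselves `C¹(U)`,
then `∂₁ g₂ = ∂₂ g₁` on `U`. [folklore] -/
theorem deriv_slice_comm (hg : ContDiffOn ℝ 2 (uncurry g) U) (hU : IsOpen U)
    {g₁ g₂ : ℝ → ℝ → ℝ}
    (h₁ : ∀ z ∈ U, fderiv ℝ (uncurry g) z (1, 0) = g₁ z.1 z.2)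
    (h₂ : ∀ z ∈ U, fderiv ℝ (uncurry g) z (0, 1) = g₂ z.1 z.2)
    (hg₁ : ContDiffOn ℝ 1 (uncurry g₁) U) (hg₂ : ContDiffOn ℝ 1 (uncurry g₂) U)
    {ρ ϑ : ℝ} (hz : (ρ, ϑ) ∈ U) :
    deriv (fun x => g₂ x ϑ) ρ = deriv (fun θ => g₁ ρ θ) ϑ := by
  set G := uncurry g with hGdef
  obtain ⟨hDdiff, -⟩ := differentiableOn_fderiv_uncurry hg hU
  have hzn : U ∈ 𝓝 (ρ, ϑ) := hU.mem_nhds hz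
  have hsymm : IsSymmSndFDerivAt ℝ G (ρ, ϑ) :=
    (hg.contDiffAt hzn).isSymmSndFDerivAt (by simp)
  have hDat : DifferentiableAt ℝ (fderiv ℝ G) (ρ, ϑ) := (hDdiff _ hz).differentiableAt hzn
  -- `y ↦ DG(y) w` has derivative `D²G(z)(·)(w)`
  have key : ∀ v w : ℝ × ℝ,
      fderiv ℝ (fun y => fderiv ℝ G y w) (ρ, ϑ) v = fderiv ℝ (fderiv ℝ G) (ρ, ϑ) v w := by
    intro v w
    rw [fderiv_clm_apply hDat (differentiableAt_const w)]
    simp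
  -- identify `y ↦ DG(y)(1,0)` with `uncurry g₁` and `y ↦ DG(y)(0,1)` with `uncurry g₂` near `z`
  have hev₁ : (fun y => fderiv ℝ G y (1, 0)) =ᶠ[𝓝 (ρ, ϑ)] uncurry g₁ := by
    filter_upwards [hzn] with y hy
    exact h₁ y hy
  have hev₂ : (fun y => fderiv ℝ G y (0, 1)) =ᶠ[𝓝 (ρ, ϑ)] uncurry g₂ := by
    filter_upwards [hzn] with y hy
    exact h₂ y hy
  have e₁ : fderiv ℝ (fderiv ℝ G) (ρ, ϑ) (0, 1) (1, 0) = deriv (fun θ => g₁ ρ θ) ϑ := by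
    rw [← key, hev₁.fderiv_eq, deriv_slice_snd hg₁ hU le_rfl hz]
  have e₂ : fderiv ℝ (fderiv ℝ G) (ρ, ϑ) (1, 0) (0, 1) = deriv (fun x => g₂ x ϑ) ρ := by
    rw [← key, hev₂.fderiv_eq, deriv_slice_fst hg₂ hU le_rfl hz]
  rw [← e₁, ← e₂]
  exact hsymm (1, 0) (0, 1)

end TwoVarC2

namespace EulerEOS

variable {eos : EulerEOS}

/-! ## The `ϑ`-derivative of the chemical potential -/

/-- `∂_Θ μ(r,Θ) = -s(r,Θ) + ∂_ϑ p(r,Θ)/r` (Gibbs–Duhem: `dμ = dp/ρ - s dϑ`).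
[cite: FeireislNovotny2009, §1.4] -/
theorem IsGibbs.hasDerivAt_chemPotential_theta (hG : eos.IsGibbs) {r Θ : ℝ} (hr : 0 < r)
    (hΘ : 0 < Θ) :
    HasDerivAt (fun θ => eos.chemPotential r θ)
      (-(eos.s r Θ) + deriv (fun θ => eos.p r θ) Θ / r) Θ := by
  have he := hG.hasDerivAt_e_theta hr hΘ
  have hs := hG.hasDerivAt_s_theta hr hΘ
  have hp := hG.hasDerivAt_p_theta hr hΘ
  have hgibbs := hG.theta_mul_deriv_s_theta hr hΘ
  have h : HasDerivAt (fun θ => eos.e r θ - θ * eos.s r θ + eos.p r θ / r)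
      (deriv (fun θ => eos.e r θ) Θ - (1 * eos.s r Θ + Θ * deriv (fun θ => eos.s r θ) Θ) +
        deriv (fun θ => eos.p r θ) Θ / r) Θ :=
    (he.fun_sub ((hasDerivAt_id' Θ).fun_mul hs)).fun_add (hp.div_const r)
  unfold chemPotential
  refine h.congr_deriv ?_
  rw [← hgibbs]; ring

/-! ## Maxwell's relation -/

/-- The partial derivatives of the Helmholtz free energy on the open quadrant:
`∂_ρ f = p/ρ²` and `∂_ϑ f = -s` (Gibbs' relation). [cite: FeireislNovotny2009, §1.4] -/
theorem IsGibbs.fderiv_helmholtz (hG : eos.IsGibbs) {z : ℝ × ℝ} (hz : z ∈ Ioi 0 ×ˢ Ioi 0) :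
    fderiv ℝ (uncurry eos.helmholtz) z (1, 0) = eos.p z.1 z.2 / z.1 ^ 2 ∧
    fderiv ℝ (uncurry eos.helmholtz) z (0, 1) = -(eos.s z.1 z.2) := by
  obtain ⟨ρ, ϑ⟩ := z
  have hρ : 0 < ρ := hz.1
  have hϑ : 0 < ϑ := hz.2
  have hF : ContDiffOn ℝ 1 (uncurry eos.helmholtz) (Ioi 0 ×ˢ Ioi 0) := by
    have : uncurry eos.helmholtz = fun z : ℝ × ℝ => eos.e z.1 z.2 - z.2 * eos.s z.1 z.2 := by
      funext z; rfl
    rw [this]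
    exact hG.2.1.sub (contDiffOn_snd.mul hG.2.2.1)
  constructor
  · rw [← deriv_slice_fst hF isOpen_quadrant le_rfl hz]
    have h : HasDerivAt (fun x => eos.e x ϑ - ϑ * eos.s x ϑ)
        (deriv (fun x => eos.e x ϑ) ρ - ϑ * deriv (fun x => eos.s x ϑ) ρ) ρ :=
      (hG.hasDerivAt_e_rho hρ hϑ).fun_sub ((hG.hasDerivAt_s_rho hρ hϑ).const_mul ϑ)
    have := hG.theta_mul_deriv_s_rho hρ hϑ
    show deriv (fun x => eos.helmholtz x ϑ) ρ = _
    unfold helmholtz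
    rw [h.deriv]
    simp only
    linarith
  · rw [← deriv_slice_snd hF isOpen_quadrant le_rfl hz]
    have h : HasDerivAt (fun θ => eos.e ρ θ - θ * eos.s ρ θ)
        (deriv (fun θ => eos.e ρ θ) ϑ - (1 * eos.s ρ ϑ + ϑ * deriv (fun θ => eos.s ρ θ) ϑ)) ϑ :=
      (hG.hasDerivAt_e_theta hρ hϑ).fun_sub ((hasDerivAt_id' ϑ).fun_mul (hG.hasDerivAt_s_theta hρ hϑ))
    have := hG.theta_mul_deriv_s_theta hρ hϑ
    show deriv (fun θ => eos.helmholtz ρ θ) ϑ = _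
    unfold helmholtz
    rw [h.deriv]
    simp only
    linarith

/-- **Maxwell's relation** `∂_ρ s(ρ,ϑ) = -∂_ϑ p(ρ,ϑ)/ρ²` on the open quadrant, for `C²`
constitutive functions satisfying Gibbs' relation: the symmetry of the Hessian of the Helmholtz
free energy `f = e - ϑ s` (`∂_ρ f = p/ρ²`, `∂_ϑ f = -s`). [cite: FeireislNovotny2009, §1.4] -/
theorem IsGibbs.maxwell (hG : eos.IsGibbs)
    (hp2 : ContDiffOn ℝ 2 (uncurry eos.p) (Ioi 0 ×ˢ Ioi 0))
    (he2 : ContDiffOn ℝ 2 (uncurry eos.e) (Ioi 0 ×ˢ Ioi 0))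
    (hs2 : ContDiffOn ℝ 2 (uncurry eos.s) (Ioi 0 ×ˢ Ioi 0)) {ρ ϑ : ℝ} (hρ : 0 < ρ) (hϑ : 0 < ϑ) :
    deriv (fun x => eos.s x ϑ) ρ = -(deriv (fun θ => eos.p ρ θ) ϑ) / ρ ^ 2 := by
  have hz : (ρ, ϑ) ∈ Ioi (0 : ℝ) ×ˢ Ioi (0 : ℝ) := ⟨hρ, hϑ⟩
  have hF : ContDiffOn ℝ 2 (uncurry eos.helmholtz) (Ioi 0 ×ˢ Ioi 0) := by
    have : uncurry eos.helmholtz = fun z : ℝ × ℝ => eos.e z.1 z.2 - z.2 * eos.s z.1 z.2 := by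
      funext z; rfl
    rw [this]
    exact he2.sub (contDiffOn_snd.mul hs2)
  -- the two partial derivatives as `C¹` functions of two variables
  set g₁ : ℝ → ℝ → ℝ := fun a b => eos.p a b / a ^ 2 with hg₁
  set g₂ : ℝ → ℝ → ℝ := fun a b => -(eos.s a b) with hg₂
  have hg₁c : ContDiffOn ℝ 1 (uncurry g₁) (Ioi 0 ×ˢ Ioi 0) := by
    have : uncurry g₁ = fun z : ℝ × ℝ => eos.p z.1 z.2 / z.1 ^ 2 := by funext z; rfl
    rw [this]
    exact (hp2.of_le (by norm_num)).div (contDiffOn_fst.pow 2) fun z hz => by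
      have : (0 : ℝ) < z.1 := hz.1
      positivity
  have hg₂c : ContDiffOn ℝ 1 (uncurry g₂) (Ioi 0 ×ˢ Ioi 0) := by
    have : uncurry g₂ = fun z : ℝ × ℝ => -(eos.s z.1 z.2) := by funext z; rfl
    rw [this]
    exact (hs2.of_le (by norm_num)).neg
  have hcomm := deriv_slice_comm hF isOpen_quadrant (g₁ := g₁) (g₂ := g₂)
    (fun z hz => (hG.fderiv_helmholtz hz).1) (fun z hz => (hG.fderiv_helmholtz hz).2) hg₁c hg₂c hz
  -- `hcomm : deriv (fun x => -s x ϑ) ρ = deriv (fun θ => p ρ θ / ρ²) ϑ`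
  simp only [hg₁, hg₂] at hcomm
  rw [deriv.fun_neg, deriv_div_const] at hcomm
  have hρ2 : ρ ^ 2 ≠ 0 := by positivity
  field_simp
  field_simp at hcomm
  linarith

end EulerEOS

end CompressibleEuler

end Literature.Analysis.FluidPDE
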